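import Summits.BirchSwinnertonDyer.BirchSwinnertonDyer.Theses.KatoDescentPotSupersingular
import HarnessLib

/-!
# Route `KatoDescentPotSupersingular` (rung K9, cell `bsd-potss`): the `Assembly` item
# (stmt-BirchSwinnertonDyer-19201) — pure logic, PROVED

`WildLowerHalfRankZero → ReducibleKatoMember → WildUpperDefectRankZero → PublishedInputsO6 →
WildRankZeroAssembly → WildRankOne → O6Sharp`: `ClassO6 W p` forces `p = 3` (`ClassO6.p_eq_three`);
split `r_an = 0` (covered rows through the rank-0 assembly support, defect rows through L₀ + U₀ +
`missingPPartAt_of_lower_of_upper`) / `r_an = 1` (the declared residual). Identical in content to the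
route's deciding theorem `closes` (planner g7's glue); landed as the item's own closing theorem.
Seat `bsd-potss-kmc` generation 4. Nothing about the cruxes is asserted.
-/

set_option autoImplicit false
set_option linter.dupNamespace false

noncomputable section

open scoped Classical

namespace Summit.BirchSwinnertonDyer.BirchSwinnertonDyer.Theorems

/-- **The K9 `Assembly` item, proved** (route `KatoDescentPotSupersingular`, item
stmt-BirchSwinnertonDyer-19201): cruxes + supports + residual ⇒ the rung leaf `O6Sharp`, by the case
split `p = 3`, `r_an ∈ {0, 1}`, covered / defect rows. [cite: Miller2011LMS, §1 and Def. 1.1] -/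
theorem katoDescentPotSupersingular_assembly_proof :
    Summit.BirchSwinnertonDyer.BirchSwinnertonDyer.Theses.KatoDescentPotSupersingular.Assembly := by
  intro h₂ h₃ h₄ hP hA hR W _ _ p hp hr hO
  obtain rfl : p = 3 :=
    Summit.BirchSwinnertonDyer.Rank1Residual.Additive.ClassO6.p_eq_three (W := W) (p := p) hO
  rcases Nat.le_one_iff_eq_zero_or_eq_one.mp hr with h0 | h1
  · by_cases hcov :
        ((∀ n : ℕ, W.HasSurjectiveModNGaloisRep (3 ^ n : ℕ)) ∧ ¬ 3 ∣ W.tamagawaProduct ∧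
            ∃ (N : ℕ) (_ : NeZero N)
              (D : Literature.NumberTheory.EllipticCurves.ModularForms.ModularParametrizationData W N),
              ¬ (3 : ℤ) ∣ D.maninConstant) ∨
          (¬ W.HasIrreducibleModPGaloisRep 3 ∧
            (∀ (W' : WeierstrassCurve ℚ) [W'.IsElliptic],
                WeierstrassCurve.IsIsogenous W W' → ¬ 3 ^ 2 ∣ W'.torsionOrder) ∧
            ∀ q : ℚ, Literature.NumberTheory.EllipticCurves.shaAn W = (q : ℂ) → Even (padicValRat 3 q))
    · exact hA h₂ h₃ hP W h0 hO hcov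
    · exact Literature.NumberTheory.EllipticCurves.Rank1Residual.Typed.missingPPartAt_of_lower_of_upper W 3
        (h₂ W h0 hO) (h₄ W h0 hO hcov)
  · exact hR W h1 hO

end Summit.BirchSwinnertonDyer.BirchSwinnertonDyer.Theorems

end
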